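import Summits.NavierStokesRegularity.NavierStokesRegularity.Theses.QuantisedSymmetry
import Summits.NavierStokesRegularity.NavierStokesRegularity.Theses.Blowup
import Summits.NavierStokesRegularity.NavierStokesRegularity.Theorems.QuantisedSymmetryPolyhedralDssProfileExistsDominatesBlowupProfile
import Summits.NavierStokesRegularity.NavierStokesRegularity.Theorems.QuantisedSymmetryLiouvilleKillsProfile
import Summits.NavierStokesRegularity.NavierStokesRegularity.Theorems.FilamentSkeletonRssRdssProfileTruncation
import Literature.Analysis.FluidPDE.SelfSimilarLiouville
import Literature.Analysis.Calculus.NewtonKantorovichHolds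
import HarnessLib

/-!
# Strategist sketch `s17-g2` (family `s`, gen 2 — SECOND INDEPENDENT STRATEGY CENSUS) for the crux
# `QuantisedSymmetry.PolyhedralDssProfileExists` (X⁻, stmt-NavierStokesRegularity-1404)

Kernel-checked signatures cited by `STRATEGY-CENSUS-s17.md` (gen 2).  Nothing here is a registered
line: the seat's verdict is `no-strategy-short-of-summit`, and this file records WHY in Lean:

* §1 WEAKER INTERMEDIATES.  Every statement on the chain
  `X⁻ → PlainTypeIDssProfileExists (drop G) → RdssTypeIProfileExists (allow a rotation) →
  Blowup.BlowupExists (finite lifespan, X5a) → ¬ NavierStokesRegularity`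
  is PROVED to imply the next one from tree theorems (`filamentSkeletonRss_rdssProfileTruncation_proof`,
  `Blowup.closes`, `Blowup.BlowupClayUniqueness_holds`); so every admissible replacement of the crux in
  `closes` is itself summit-bearing (⊢ ¬S) and none is known to follow from ¬S.
* §2 DECOMPOSITION.  The Newton–Kantorovich bridge split typed ABSTRACTLY (certificate piece over an
  arbitrary Banach formulation + the in-tree theorem `Literature.Analysis.Calculus.NewtonKantorovich_holds`)
  COLLAPSES: `NKCertificate ℝ ℝ ↔ X⁻` (`nkCertificate_iff_X`).  An NK split has content only over a FIXED
  concrete formulation (the `S`-periodic Leray map in a Type-I weighted space), for which no candidate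
  `x0` exists.
* §3 NEGATION.  The kill switch is in the tree: `PolyhedralTypeILiouville → ¬ X⁻`
  (`quantisedSymmetry_liouvilleKillsProfile_proof`).

Author: planner-cstrat-stmt-NavierStokesRegularity-1404-s17-g2-0, 2026-08-28.  `lean check` rc 0, no sorry.
-/

set_option linter.dupNamespace false
set_option linter.unusedVariables false

namespace Summit.NavierStokesRegularity.NavierStokesRegularity.Cruxes.PolyhedralDssProfileExists.StrategistS17g2

open MeasureTheory Set Filter Metric
open Literature.Analysis.FluidPDE

/-- The crux, by name. -/
abbrev X : Prop :=
  _root_.Summit.NavierStokesRegularity.NavierStokesRegularity.Theses.QuantisedSymmetry.PolyhedralDssProfileExists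

/-! ## §1 Weaker intermediates: the chain X⁻ → W₁ → W₂ → X5a → ¬S, every arrow a tree theorem -/

/-- **W₁** — sector-free Type-I `λ`-DSS nontrivial ancient mild profile (drop the group `G`):
literally `∃ c > 1, ¬ TypeIDSSLiouville c` (see `plain_iff_exists_not_typeIDSSLiouville`), the negation of
Tsai's Conj. 8.8 at one factor; the DSS conjunct of `Blowup.BlowupTypeIDssProfile` (stmt-0155). -/
def PlainTypeIDssProfileExists : Prop :=
  ∃ c : ℝ, 1 < c ∧ ∃ u : ℝ → EuclideanSpace ℝ (Fin 3) → EuclideanSpace ℝ (Fin 3),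
    IsAncientMildSolution 1 u ∧ (∀ t < 0, AEStronglyMeasurable (u t) volume) ∧
      IsDiscretelySelfSimilar c u ∧ (∃ C₀ : ℝ, HasTypeIDecay C₀ u) ∧ ¬ (∀ t < 0, u t =ᵐ[volume] 0)

/-- **W₂** — sector-free Type-I ROTATED `λ`-DSS nontrivial ancient mild profile: verbatim the antecedent
of the proved conjecture-free bridge `FilamentSkeletonRss.RdssProfileTruncation` (stmt-11289). -/
def RdssTypeIProfileExists : Prop :=
  ∃ (c : ℝ) (R : EuclideanSpace ℝ (Fin 3) ≃ₗᵢ[ℝ] EuclideanSpace ℝ (Fin 3))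
    (u : ℝ → EuclideanSpace ℝ (Fin 3) → EuclideanSpace ℝ (Fin 3)),
    1 < c ∧ IsAncientMildSolution 1 u ∧ (∀ t < 0, AEStronglyMeasurable (u t) volume) ∧
      IsRotatedDSS c R u ∧ (∃ C₀ : ℝ, HasTypeIDecay C₀ u) ∧ ¬ (∀ t < 0, u t =ᵐ[volume] 0)

/-- X⁻ → W₁ (forget the group). -/
theorem plain_of_X (hX : X) : PlainTypeIDssProfileExists := by
  obtain ⟨G, -, -, -, c, hc, u, hanc, hmeas, hdss, hdec, -, hnt⟩ := hX
  exact ⟨c, hc, u, hanc, hmeas, hdss, hdec, hnt⟩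

/-- W₁ is the negation of Tsai's Type-I `λ`-DSS Liouville statement at some factor. -/
theorem plain_iff_exists_not_typeIDSSLiouville :
    PlainTypeIDssProfileExists ↔ ∃ c : ℝ, 1 < c ∧ ¬ TypeIDSSLiouville c := by
  constructor
  · rintro ⟨c, hc, u, hanc, hmeas, hdss, hdec, hnt⟩
    exact ⟨c, hc, fun hL => hnt (hL hc u hanc hmeas hdss hdec)⟩
  · rintro ⟨c, hc, hL⟩
    by_contra h
    apply hL
    intro _ u hanc hmeas hdss hdec
    by_contra hnt
    exact h ⟨c, hc, u, hanc, hmeas, hdss, hdec, hnt⟩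

/-- W₁ → the sector-agnostic existence crux of route `Blowup` (stmt-0155), via the lead's landed stub. -/
theorem blowupTypeIDssProfile_of_X (hX : X) :
    _root_.Summit.NavierStokesRegularity.NavierStokesRegularity.Theses.Blowup.BlowupTypeIDssProfile :=
  Theorems.PolyhedralDssProfileExists.PolyhedralCell.stub_dominatesBlowupProfile hX

/-- W₁ → W₂ (a `λ`-DSS field is rotated-DSS with the trivial rotation). -/
theorem rdss_of_plain (h : PlainTypeIDssProfileExists) : RdssTypeIProfileExists := by
  obtain ⟨c, hc, u, hanc, hmeas, hdss, hdec, hnt⟩ := h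
  exact ⟨c, LinearIsometryEquiv.refl ℝ _, u, hc, hanc, hmeas, isRotatedDSS_refl_iff.mpr hdss, hdec, hnt⟩

/-- W₂ → X5a (finite maximal lifespan from a rapidly decaying datum): the PROVED truncation bridge. -/
theorem blowupExists_of_rdss (h : RdssTypeIProfileExists) :
    _root_.Summit.NavierStokesRegularity.NavierStokesRegularity.Theses.Blowup.BlowupExists := by
  have hT := Theorems.filamentSkeletonRss_rdssProfileTruncation_proof
  unfold Theses.FilamentSkeletonRss.RdssProfileTruncation at hT
  exact hT h

/-- X5a → ¬S (route `Blowup`'s deciding theorem with the PROVED Clay-class uniqueness). -/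
theorem not_clay_of_blowupExists
    (h : _root_.Summit.NavierStokesRegularity.NavierStokesRegularity.Theses.Blowup.BlowupExists) :
    ¬ _root_.NavierStokesRegularity :=
  Theses.Blowup.closes h Theses.Blowup.BlowupClayUniqueness_holds

/-- Hence the weakest typed intermediate W₂ is ALREADY summit-bearing … -/
theorem not_clay_of_rdss (h : RdssTypeIProfileExists) : ¬ _root_.NavierStokesRegularity :=
  not_clay_of_blowupExists (blowupExists_of_rdss h)

/-- … and so is W₁ … -/
theorem not_clay_of_plain (h : PlainTypeIDssProfileExists) : ¬ _root_.NavierStokesRegularity :=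
  not_clay_of_rdss (rdss_of_plain h)

/-- … and X⁻ alone decides the summit negatively (as the route's `closes` does with its proved items). -/
theorem not_clay_of_X (hX : X) : ¬ _root_.NavierStokesRegularity :=
  not_clay_of_plain (plain_of_X hX)

/-! ## §2 Decomposition: the abstract Newton–Kantorovich split collapses to the crux -/

/-- **D₁, piece A typed ABSTRACTLY**: over Banach spaces `V, W`, Kantorovich data (Deuflhard Thm 2.1
hypotheses, in-tree structure `Literature.Analysis.Calculus.KantorovichData`) whose every zero in the
existence ball realises X⁻.  The intended instance is the `S`-periodic Leray map around a numerical
`G`-equivariant candidate; but the typing quantifies over the soundness clause, and that is the leak. -/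
def NKCertificate (V W : Type) [NormedAddCommGroup V] [NormedSpace ℝ V] [CompleteSpace V]
    [NormedAddCommGroup W] [NormedSpace ℝ W] [CompleteSpace W] : Prop :=
  ∃ d : Literature.Analysis.Calculus.KantorovichData V W,
    closedBall d.x0 d.rhoMinus ⊆ d.D ∧ ∀ v ∈ closedBall d.x0 d.rhoMinus, d.F v = 0 → X

/-- **D₁ assembly (proved)**: piece A + piece B (the Newton–Kantorovich theorem, a NAMED FACT PROVED in the
tree, `NewtonKantorovich_holds`) ⊢ X⁻ — modus ponens through the NK zero. -/
theorem X_of_nkCertificate (V W : Type) [NormedAddCommGroup V] [NormedSpace ℝ V] [CompleteSpace V]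
    [NormedAddCommGroup W] [NormedSpace ℝ W] [CompleteSpace W] (hA : NKCertificate V W)
    (hNK : Literature.Analysis.Calculus.NewtonKantorovich) : X := by
  obtain ⟨d, hball, hsound⟩ := hA
  obtain ⟨x, -, -, xstar, hx, hF, -⟩ := hNK V W d hball
  exact hsound xstar hx hF

/-- Piece B discharged: the certificate piece alone gives X⁻. -/
theorem X_of_nkCertificate' (V W : Type) [NormedAddCommGroup V] [NormedSpace ℝ V] [CompleteSpace V]
    [NormedAddCommGroup W] [NormedSpace ℝ W] [CompleteSpace W] (hA : NKCertificate V W) : X :=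
  X_of_nkCertificate V W hA Literature.Analysis.Calculus.NewtonKantorovich_holds

/-- **COLLAPSE**: X⁻ implies the abstractly typed certificate (cheat formulation `F = id` on `ℝ`, exact zero
`x0 = 0`, soundness clause := the assumed proof of X⁻).  So `NKCertificate` as typed is EQUIVALENT to the
crux — a costume (BC2 (c): the `T` of a bridge split `T ∧ (T → X)` must be substantive). -/
theorem nkCertificate_real_of_X (hX : X) : NKCertificate ℝ ℝ := by
  refine ⟨{ F := id, F' := fun _ => ContinuousLinearMap.id ℝ ℝ, D := univ, x0 := 0,
            G := ContinuousLinearMap.id ℝ ℝ, α := 0, ω := 1,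
            isOpen_D := isOpen_univ, convex_D := convex_univ, x0_mem := mem_univ _,
            hasFDerivAt := fun x _ => hasFDerivAt_id x,
            continuousOn_F' := continuousOn_const,
            G_left := fun v => rfl, G_right := fun w => rfl,
            norm_G_F_le := by simp,
            lipschitz := by
              intro x _ y _
              simp only [sub_self, ContinuousLinearMap.comp_zero, norm_zero]
              positivity,
            ω_pos := one_pos, h0_le := by norm_num }, subset_univ _, fun _ _ _ => hX⟩

/-- The abstract NK split is exactly as strong as the crux. -/
theorem nkCertificate_iff_X : NKCertificate ℝ ℝ ↔ X :=
  ⟨fun h => X_of_nkCertificate' ℝ ℝ h, nkCertificate_real_of_X⟩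

/-! ## §3 Negation: the kill switch is wired -/

/-- `PolyhedralTypeILiouville` (item #3, stmt-1405) refutes X⁻ (tree: `quantisedSymmetry_liouvilleKillsProfile_proof`). -/
theorem not_X_of_liouville
    (hL : _root_.Summit.NavierStokesRegularity.NavierStokesRegularity.Theses.QuantisedSymmetry.PolyhedralTypeILiouville) :
    ¬ X := by
  have h := Theorems.quantisedSymmetry_liouvilleKillsProfile_proof
  unfold Theses.QuantisedSymmetry.LiouvilleKillsProfile at h
  exact h hL

/-- Conversely a witness of X⁻ refutes Tsai's `λ`-DSS Liouville statement at its factor (lead's landed lemma). -/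
theorem exists_not_typeIDSSLiouville_of_X (hX : X) : ∃ c : ℝ, 1 < c ∧ ¬ TypeIDSSLiouville c :=
  Theorems.PolyhedralDssProfileExists.PolyhedralCell.exists_not_typeIDSSLiouville_of_polyhedralDssProfileExists hX

end Summit.NavierStokesRegularity.NavierStokesRegularity.Cruxes.PolyhedralDssProfileExists.StrategistS17g2
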